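import Summits.NavierStokesRegularity.NavierStokesRegularity.Theorems.TypeIliouvilleNoTypeII.Negative.NSISuperCascadePowerGaugeD
import HarnessLib

/-!
# The power-zoomable Type-II portrait of the NSI super-cascade, with the full gauge (G3)

Negative-lane support file for `stmt-NavierStokesRegularity-0056` (kill-kit, model class M2′;
referee note C24 of SCORE-wave-19h-0827): the one-declaration portrait of the super-similar NSI
cascade `𝔲 = glueG T σ τ a z u` on Seregin's Euler line `a = τ^{-(1+ρ)}`, now carrying the pressure
gauge `r^{2ρ} D` (`NSISuperCascadePowerGaugeD.exists_powerGauges_le`), so that it lists, at the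
blow-up point `z₀ = (T₀, x₀)` and in the SHAPE of the hypotheses of the §B route `EulerZoomLiouville`
(`TypeIOrPowerZoomable` second disjunct / `SereginZoomReduction`, `r₀ = √T₀`):

* (NSI) weak Navier–Stokes INEQUALITY for every `ν ∈ [0, ν₀]` — in place of (G1), the NS identity;
* (¬I) the blow-up at `T₀` is not of Type I;
* (G2) `D𝔲` is a weak spatial gradient on `Q_{r₀}(z₀)`;
* (G3) `∃ M : ℝ≥0, ∀ r ∈ (0, r₀], r^{2ρ} A + r^{ρ} E + r^{2ρ} D ≤ M` (in fact for all `r > 0`);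
* (G4) the `L³` floor on the Euler cylinders `Q^{ρ}_r(z₀)` along `r → 0`.

Hence (G2)–(G4) together with the local energy inequality do not exclude the power-zoomable
Type-II portrait: any proof of `TypeIOrPowerZoomable`-exclusion / of the crux
`PowerGaugeEulerLiouville` must use the momentum IDENTITY (G1). WHAT THIS IS NOT: nothing about
NS/Euler solutions (the cascade solves the NS inequality only); no new definitions.

References: Seregin, arXiv:2402.13229 (2024), (1.7), Thm 3.1; Ożański, arXiv:1709.00602 (2017),
§2, §5 [`Ozanski2017NSISingular`]; CKN 1982, (2.5).
-/

noncomputable section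

open MeasureTheory Set Function Filter Topology Metric Module
open scoped ENNReal NNReal

set_option linter.dupNamespace false

namespace Summit.NavierStokesRegularity.NavierStokesRegularity.Theorems.TypeIliouvilleNoTypeIINegative

open Literature.Analysis.FluidPDE Literature.Barriers.NavierStokesRegularity
open Literature.Barriers.NavierStokesRegularity.Scheffer TopologicalSpace

namespace IsSuperBlock

variable {T ν₀ τ σ a : ℝ} {z : EuclideanSpace ℝ (Fin 3)} {G : Set (EuclideanSpace ℝ (Fin 3))}
  {u : ℝ → EuclideanSpace ℝ (Fin 3) → EuclideanSpace ℝ (Fin 3)} {ρ : ℝ}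

/-- The full power-gauge bound (G3) in the `ℝ≥0`-valued, `r ∈ (0, r₀]` shape of
`TypeIOrPowerZoomable` / `SereginZoomReduction`, at every centre and for EVERY `r₀`.
[cite: Ozanski2017NSISingular, §2] -/
theorem exists_powerGauges_le_nnreal (h : IsSuperBlock T ν₀ τ σ a z G u)
    (hρ : a = τ ^ (-(1 + ρ))) (z₀ : ℝ × EuclideanSpace ℝ (Fin 3)) (r₀ : ℝ) :
    ∃ M : ℝ≥0, ∀ r ∈ Ioc 0 r₀,
      ENNReal.ofReal (r ^ (2 * ρ)) * cknA r z₀ (glueG T σ τ a z u) +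
        ENNReal.ofReal (r ^ ρ) * cknE r z₀ (fun s x => fderiv ℝ (glueG T σ τ a z u s) x) +
        ENNReal.ofReal (r ^ (2 * ρ)) * cknD r z₀ (fun s => normalisedPressure (glueG T σ τ a z u s)) ≤
      (M : ℝ≥0∞) := by
  obtain ⟨M, -, hM⟩ := h.exists_powerGauges_le hρ
  exact ⟨Real.toNNReal M, fun r hr => hM z₀ r hr.1⟩

/-- **The super-similar NSI cascade is a power-zoomable Type-II portrait (full gauge).** For an
`IsSuperBlock` datum on the Euler line `a = τ^{-(1+ρ)}` (necessarily `0 < ρ < 1/2`), at the blow-up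
point `z₀ = (T₀, x₀)` of `𝔲 = glueG T σ τ a z u`, with `r₀ = √T₀ > 0`, pressure `p = p̃[𝔲]` and
gradient `D𝔲`: (NSI) for every `ν ∈ [0, ν₀]`; (¬I); (G2) on `Q_{r₀}(z₀)`; (G3) in full,
`r^{2ρ} A + r^{ρ} E + r^{2ρ} D ≤ M` for `r ∈ (0, r₀]`; (G4) the `L³` floor on `Q^{ρ}_r(z₀)`.
These are the hypotheses (G2)–(G4) of `SereginZoomReduction` verbatim; only (G1) is replaced by the
NS inequality. [cite: Ozanski2017NSISingular, §2] -/
theorem powerZoomable_portrait_full (h : IsSuperBlock T ν₀ τ σ a z G u) (hρ : a = τ ^ (-(1 + ρ))) :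
    (0 < ρ ∧ ρ < 1 / 2) ∧ 0 < Real.sqrt (blowupTime T σ) ∧
    (∀ ν ∈ Icc 0 ν₀, IsWeakNSISolution ν (glueG T σ τ a z u)
      fun s => normalisedPressure (glueG T σ τ a z u s)) ∧
    ¬ IsTypeIBlowup (glueG T σ τ a z u) (blowupTime T σ) ∧
    HasWeakSpatialGradientOn
      (parabolicCylinderOpens (Real.sqrt (blowupTime T σ)) (blowupTime T σ, blowupPoint τ z))
      (glueG T σ τ a z u) (fun s x => fderiv ℝ (glueG T σ τ a z u s) x) ∧
    (∃ M : ℝ≥0, ∀ r ∈ Ioc 0 (Real.sqrt (blowupTime T σ)),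
      ENNReal.ofReal (r ^ (2 * ρ)) * cknA r (blowupTime T σ, blowupPoint τ z) (glueG T σ τ a z u) +
        ENNReal.ofReal (r ^ ρ) *
          cknE r (blowupTime T σ, blowupPoint τ z) (fun s x => fderiv ℝ (glueG T σ τ a z u s) x) +
        ENNReal.ofReal (r ^ (2 * ρ)) *
          cknD r (blowupTime T σ, blowupPoint τ z)
            (fun s => normalisedPressure (glueG T σ τ a z u s)) ≤ (M : ℝ≥0∞)) ∧
    (∃ ε₀ : ℝ, 0 < ε₀ ∧ ∀ δ : ℝ, 0 < δ → ∃ r ∈ Ioo 0 δ,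
      ENNReal.ofReal ε₀ ≤ ENNReal.ofReal (r ^ (2 * ρ - 2)) *
        ∫⁻ w in Ioo (blowupTime T σ - r ^ (2 + ρ)) (blowupTime T σ) ×ˢ ball (blowupPoint τ z) r,
          ‖glueG T σ τ a z u w.1 w.2‖ₑ ^ (3 : ℕ)) := by
  obtain ⟨hρ01, hNSI, hI, hG2, -, hG4⟩ := h.powerZoomable_portrait hρ
  exact ⟨hρ01, Real.sqrt_pos.2 h.blowupTime_pos', hNSI, hI, hG2,
    h.exists_powerGauges_le_nnreal hρ _ _, hG4⟩

/-- **Existence: a weak NSI solution with the full power-zoomable Type-II portrait.** There are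
`ρ ∈ (0, 1/2)`, `ν₀ > 0`, a compact `K` and a field `v` with `C^∞` slices supported in `K` — a weak
solution of the Navier–Stokes inequality for every `ν ∈ [0, ν₀]` — blowing up at some `T₀ > 0` NOT of
Type I, a point `x₀` and a radius `r₀ > 0` at which, with `p = p̃[v]` and `Dv` the slice derivative,
(G2) on `Q_{r₀}(T₀, x₀)`, (G3) `∃ M : ℝ≥0, ∀ r ∈ (0, r₀], r^{2ρ}A + r^{ρ}E + r^{2ρ}D ≤ M` and (G4) hold
— the hypotheses of `SereginZoomReduction` except the NS identity (G1).
[cite: Ozanski2017NSISingular, §2, §5] -/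
theorem exists_weakNSI_powerZoomable_full :
    ∃ ρ : ℝ, 0 < ρ ∧ ρ < 1 / 2 ∧ ∃ ν₀ : ℝ, 0 < ν₀ ∧
      ∃ (K : Set (EuclideanSpace ℝ (Fin 3)))
        (v : ℝ → EuclideanSpace ℝ (Fin 3) → EuclideanSpace ℝ (Fin 3))
        (Dv : ℝ → EuclideanSpace ℝ (Fin 3) → (EuclideanSpace ℝ (Fin 3) →L[ℝ] EuclideanSpace ℝ (Fin 3)))
        (p : ℝ → EuclideanSpace ℝ (Fin 3) → ℝ),
        IsCompact K ∧ (∀ ν ∈ Icc (0 : ℝ) ν₀, IsWeakNSISolution ν v p) ∧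
        (∀ t : ℝ, ContDiff ℝ ((⊤ : ℕ∞) : WithTop ℕ∞) (v t) ∧ tsupport (v t) ⊆ K) ∧
        ∃ (T₀ r₀ : ℝ) (x₀ : EuclideanSpace ℝ (Fin 3)), 0 < T₀ ∧ 0 < r₀ ∧ ¬ IsTypeIBlowup v T₀ ∧
          HasWeakSpatialGradientOn (parabolicCylinderOpens r₀ (T₀, x₀)) v Dv ∧
          (∃ M : ℝ≥0, ∀ r ∈ Ioc 0 r₀,
            ENNReal.ofReal (r ^ (2 * ρ)) * cknA r (T₀, x₀) v +
              ENNReal.ofReal (r ^ ρ) * cknE r (T₀, x₀) Dv +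
              ENNReal.ofReal (r ^ (2 * ρ)) * cknD r (T₀, x₀) p ≤ (M : ℝ≥0∞)) ∧
          (∃ ε₀ : ℝ, 0 < ε₀ ∧ ∀ δ : ℝ, 0 < δ → ∃ r ∈ Ioo 0 δ,
            ENNReal.ofReal ε₀ ≤ ENNReal.ofReal (r ^ (2 * ρ - 2)) *
              ∫⁻ w in Ioo (T₀ - r ^ (2 + ρ)) T₀ ×ˢ ball x₀ r, ‖v w.1 w.2‖ₑ ^ (3 : ℕ)) := by
  obtain ⟨β₀, hβ₀, -, hreach⟩ := exists_isSuperBlock_rateExp_eq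
  obtain ⟨T, ν₀, τ, σ, a, z, G, u, hS, -⟩ := hreach β₀ ⟨hβ₀, le_rfl⟩
  have hρ := hS.gain_eq_rpow
  obtain ⟨⟨hρ0, hρ1⟩, hr₀, hNSI, hI, hG2, hG3, hG4⟩ := hS.powerZoomable_portrait_full hρ
  exact ⟨_, hρ0, hρ1, ν₀, hS.block.ν₀_pos, G, glueG T σ τ a z u,
    fun s x => fderiv ℝ (glueG T σ τ a z u s) x, fun s => normalisedPressure (glueG T σ τ a z u s),
    hS.block.isCompact, hNSI, fun t => ⟨hS.contDiff_glueG_slice t, hS.tsupport_glueG_slice_subset t⟩,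
    blowupTime T σ, Real.sqrt (blowupTime T σ), blowupPoint τ z, hS.blowupTime_pos', hr₀, hI, hG2,
    hG3, hG4⟩

end IsSuperBlock

end Summit.NavierStokesRegularity.NavierStokesRegularity.Theorems.TypeIliouvilleNoTypeIINegative

end
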